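import Summits.CriticalPhenomena.Ising3DConformalLimit.Theorems.EnergyNotSigmaSquaredRungOneAdjacentMergingDefs
import Literature.Probability.LatticeModels.FarPointGoodDirections
import Literature.Probability.LatticeModels.CriticalTwoPointBounds
import Literature.Probability.LatticeModels.TwoPointSupNormMonotone
import HarnessLib

/-!
# Stub `stub_cells` of the line `dominant-shell-concentration` for the crux `RungOneAdjacentMerging`
(item stmt-CriticalPhenomena-11262, route `EnergyNotSigmaSquared`)

We prove `TowardCells` (statement of STUB 3 of
`Theorems/EnergyNotSigmaSquaredRungOneAdjacentMergingDefs.lean`): DOUBLY-TOWARD Messager–Miracle-Solé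
cone cells.  For `k ≥ 4` and a far point `x ∈ ℤ³` with `‖x‖_∞ ≥ 2^{k+4}` there is a set `U` of at
least `8^k / 4096` lattice points `u` of the dyadic shell `2^{k-1} ≤ ‖u‖_∞ ≤ 2^k` such that BOTH `u`
and `u - e₂` lie in the toward-cone of `x` (`G(x - u) ≥ G(x)`, `G(x - (u - e₂)) ≥ G(x)`, the one-sided
far-point tilt, with NO regularity assumption on `G` at scale `‖x‖`) and `G(u), G(u - e₂) ≥ g(2^{k+2})`.

Design.  The tree already contains the cube of good switch points of an ARBITRARY far source
(Aizenman–Duminil-Copin 2021, §6.2, the sets `𝔸_y(m)` and Remark 6.5 with its footnote):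
`Literature.Probability.LatticeModels.goodCube x i₀ m w` (file `FarPointGoodDirections.lean`), with
its cardinality `card_goodCube`, its position `goodCube_subset_ann` (`⊆ Ann(m, 2m)` for `2w ≤ m`) and
the DOMINATION `twoPointFree_sub_le_of_mem_goodCube` (`S(x - y) ≤ S(x - z)` for `z` in the cube and
`y ∈ Λ_w`, whenever `2dw ≤ m`, `4m ≤ ‖x‖_∞`; a chain of Messager–Miracle-Solé moves).  We take
`m = 2^{k-1} = 8·2^{k-4}`, `w = 2^{k-4}`, and `U :=` the sub-box of the cube whose offset in the
coordinate `1` is `≥ 1`, so that `u ∈ U` implies that both `u` and `u - e₂` belong to the cube; then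
`#U = (w+1)·w·(w+1) ≥ w³ = 8^k/4096`.  The domination is stated for the free state; at `β_c(3)` the
plus and free two-point functions agree (`twoPointPlus_criticalBeta_eq_twoPointFree_holds`).  The lower
bounds `g(2^{k+2}) ≤ G(u), G(u - e₂)` are the sup-norm MMS comparison
`twoPointPlus_le_of_mul_supNorm_le` (`3‖u‖_∞ ≤ 3·2^k ≤ 2^{k+2}`).

References: M. Aizenman, H. Duminil-Copin, Ann. of Math. 194 (2021), arXiv:1912.07973, §6.2,
Remark 6.5 and its footnote; A. Messager, S. Miracle-Solé, J. Stat. Phys. 17 (1977); H. Duminil-Copin,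
Lectures on the Ising and Potts models (2019), Exercise 37.
-/

noncomputable section

open Finset
open Literature.Probability.LatticeModels

namespace Summit.CriticalPhenomena.Ising3DConformalLimit.RungOneAdjacentMergingDominantShell

/-! ### Helper lemmas -/

/-- At `β_c(3)` the plus-state two-point function is the free one:
`G(z) = ⟨σ₀σ_z⟩^f_{β_c}` (Aizenman–Duminil-Copin–Sidoravicius 2015). [folklore] -/
theorem Gc_eq_twoPointFree (z : Site 3) : Gc z = twoPointFree 3 (criticalBeta 3) z :=
  twoPointPlus_criticalBeta_eq_twoPointFree_holds (d := 3) (by norm_num) z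

/-- **Toward-cone domination on the cube of good switch points** (ADC21 Remark 6.5, footnote):
if `i₀` is a dominant coordinate of `x`, `6w ≤ m` and `4m ≤ ‖x‖_∞`, then `G(x) ≤ G(x - z)` for every
`z ∈ goodCube x i₀ m w`. [cite: AizenmanDuminilCopinAnnals2021, arXiv:1912.07973 §6.2, Remark 6.5 and its footnote (p. 23)] -/
theorem Gc_le_Gc_sub_of_mem_goodCube {x : Site 3} {i₀ : Fin 3}
    (hi₀ : (x i₀).natAbs = Site.supNorm x) {m w : ℕ} (hw : 2 * 3 * w ≤ m)
    (hx : 4 * m ≤ Site.supNorm x) {z : Site 3} (hz : z ∈ goodCube x i₀ m w) :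
    Gc x ≤ Gc (x - z) := by
  have h := twoPointFree_sub_le_of_mem_goodCube (β := criticalBeta 3) (criticalBeta_nonneg 3) hi₀ hw
    hx hz (zero_mem_box 3 w)
  rw [sub_zero] at h
  rwa [Gc_eq_twoPointFree, Gc_eq_twoPointFree]

/-- **MMS sup-norm comparison with the axis**: if `3‖z‖_∞ ≤ n` then `g(n) ≤ G(z)`. [cite: AizenmanDuminilCopinAnnals2021, arXiv:1912.07973 §5.1, eq. (5.3)] -/
theorem axisG_le_Gc {n : ℕ} {z : Site 3} (h : 3 * Site.supNorm z ≤ n) : axisG n ≤ Gc z := by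
  unfold axisG Gc criticalTwoPoint
  refine twoPointPlus_le_of_mul_supNorm_le (criticalBeta_nonneg 3) ?_
  rw [Site.supNorm_single]
  simpa using h

/-! ### The stub -/

/-- STUB 3 (M) — DOUBLY-TOWARD MMS CONE CELLS: for `k ≥ 4` and every `x` with `‖x‖_∞ ≥ 2^{k+4}` there
is a set `U` of at least `8^k/4096` lattice points in the shell `2^{k-1} ≤ ‖u‖_∞ ≤ 2^k` such that for
every `u ∈ U` BOTH `u` and `u - e₂` lie in the toward-cone of `x`: `G(x - u) ≥ G(x)` and
`G(x - (u - e₂)) ≥ G(x)` (the one-sided far-point tilt — NO regularity of `G` at scale `‖x‖`), and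
`G(u), G(u - e₂) ≥ g(2^{k+2})`.  Construction: `i₀` a dominant coordinate of `x`, `w = 2^{k-4}`,
`m = 8w = 2^{k-1}`, `U = goodCorner x i₀ m w + ([0,w] × [1,w] × [0,w])`, a sub-box of the cube
`goodCube x i₀ m w ⊆ Ann(m, 2m)` of good switch points of Aizenman–Duminil-Copin 2021, Remark 6.5, such
that `U - e₂ ⊆ goodCube x i₀ m w` as well. [cite: AizenmanDuminilCopinAnnals2021, arXiv:1912.07973 §6.2, Remark 6.5 and its footnote (p. 23)] -/
theorem stub_cells :
    ∃ c₀ : ℝ, 0 < c₀ ∧ ∀ k : ℕ, 4 ≤ k → ∀ x : Site 3, (2 : ℝ) ^ (k + 4) ≤ ‖x‖ →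
      ∃ U : Finset (Site 3), c₀ * 8 ^ k ≤ (U.card : ℝ) ∧ ∀ u ∈ U,
        (2 : ℝ) ^ (k - 1) ≤ ‖u‖ ∧ ‖u‖ ≤ (2 : ℝ) ^ k ∧
        Gc x ≤ Gc (x - u) ∧ Gc x ≤ Gc (x - (u - e₂)) ∧
        axisG (2 ^ (k + 2)) ≤ Gc u ∧ axisG (2 ^ (k + 2)) ≤ Gc (u - e₂) := by
  refine ⟨1 / 4096, by norm_num, ?_⟩
  intro k hk x hx
  obtain ⟨k, rfl⟩ : ∃ j, k = j + 4 := ⟨k - 4, by omega⟩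
  -- the width `w = 2^k` (the scale is `k + 4`), `m = 8w = 2^{k+3}`, `‖x‖_∞ = N ≥ 256 w`
  set w : ℕ := 2 ^ k with hw
  have hw0 : 0 < w := by positivity
  set N : ℕ := Site.supNorm x with hN
  have hxN : (256 * w : ℕ) ≤ N := by
    have h1 : ‖x‖ = (N : ℝ) := Site.norm_eq_supNorm x
    have h2 : ((256 * w : ℕ) : ℝ) = (2 : ℝ) ^ (k + 4 + 4) := by
      push_cast [hw]; ring
    have h3 : ((256 * w : ℕ) : ℝ) ≤ (N : ℝ) := by rw [h2, ← h1]; exact hx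
    exact_mod_cast h3
  obtain ⟨i₀, hi₀⟩ := Site.exists_natAbs_eq_supNorm (d := 3) ⟨0, mem_univ _⟩ x
  have h6 : 2 * 3 * w ≤ 8 * w := by omega
  have h4 : 4 * (8 * w) ≤ Site.supNorm x := by omega
  -- the cells
  set c : Site 3 := goodCorner x i₀ (8 * w) w with hc
  set T : Finset (Site 3) :=
    Fintype.piFinset fun j : Fin 3 => if j = 1 then Icc (1 : ℤ) w else Icc (0 : ℤ) w with hT
  refine ⟨T.image fun t => c + t, ?_, ?_⟩
  · -- cardinality: `#U = (w+1)·w·(w+1) ≥ w³ = 8^k = 8^{k+4}/4096`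
    rw [card_image_of_injective _ (add_right_injective c), hT, Fintype.card_piFinset,
      Fin.prod_univ_three]
    simp only [if_false, if_true, Int.card_Icc, show (2 : Fin 3) ≠ 1 from by decide,
      show ¬ ((0 : Fin 3) = 1) from by decide]
    have e1 : ((w : ℤ) + 1 - 0).toNat = w + 1 := by omega
    have e2 : ((w : ℤ) + 1 - 1).toNat = w := by omega
    rw [e1, e2]
    have h8 : (1 / 4096 : ℝ) * 8 ^ (k + 4) = (w : ℝ) ^ 3 := by
      have h : (8 : ℝ) ^ k = (w : ℝ) ^ 3 := by
        rw [hw, Nat.cast_pow, ← pow_mul, mul_comm k 3, pow_mul]; norm_num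
      rw [pow_add, ← h]; ring
    rw [h8]
    have h9 : w ^ 3 ≤ (w + 1) * w * (w + 1) := by
      calc w ^ 3 = w * w * w := by ring
        _ ≤ (w + 1) * w * (w + 1) := by gcongr <;> omega
    exact_mod_cast h9
  · intro u hu
    rw [mem_image] at hu
    obtain ⟨t, ht, rfl⟩ := hu
    rw [hT, Fintype.mem_piFinset] at ht
    -- both `c + t` and `c + t - e₂` lie in the cube of good switch points
    have hu1 : c + t ∈ goodCube x i₀ (8 * w) w := by
      rw [mem_goodCube_iff]
      intro j
      have h := ht j
      by_cases hj : j = 1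
      · subst hj
        rw [if_pos rfl, mem_Icc] at h
        simp only [hc, Pi.add_apply, add_sub_cancel_left]
        omega
      · rw [if_neg hj, mem_Icc] at h
        simp only [hc, Pi.add_apply, add_sub_cancel_left]
        omega
    have hu2 : c + t - e₂ ∈ goodCube x i₀ (8 * w) w := by
      rw [mem_goodCube_iff]
      intro j
      have h := ht j
      by_cases hj : j = 1
      · subst hj
        rw [if_pos rfl, mem_Icc] at h
        simp only [hc, e₂, Pi.add_apply, Pi.sub_apply, Pi.single_eq_same]
        omega
      · rw [if_neg hj, mem_Icc] at h
        simp only [hc, e₂, Pi.add_apply, Pi.sub_apply, Pi.single_eq_of_ne hj]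
        omega
    have hann1 := mem_ann.1 (goodCube_subset_ann x i₀ (by omega : 2 * w ≤ 8 * w) hu1)
    have hann2 := mem_ann.1 (goodCube_subset_ann x i₀ (by omega : 2 * w ≤ 8 * w) hu2)
    have hk1 : (2 : ℝ) ^ (k + 4 - 1) = ((8 * w : ℕ) : ℝ) := by
      rw [show k + 4 - 1 = k + 3 from by omega, pow_add]; push_cast [hw]; ring
    have hk0 : (2 : ℝ) ^ (k + 4) = ((2 * (8 * w) : ℕ) : ℝ) := by
      rw [pow_add]; push_cast [hw]; ring
    have hk2 : 2 ^ (k + 4 + 2) = 64 * w := by rw [hw, pow_add]; ring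
    refine ⟨?_, ?_, Gc_le_Gc_sub_of_mem_goodCube hi₀ h6 h4 hu1,
      Gc_le_Gc_sub_of_mem_goodCube hi₀ h6 h4 hu2, axisG_le_Gc ?_, axisG_le_Gc ?_⟩
    · rw [hk1, Site.norm_eq_supNorm]; exact_mod_cast hann1.1
    · rw [hk0, Site.norm_eq_supNorm]; exact_mod_cast hann1.2
    · rw [hk2]; omega
    · rw [hk2]; omega

end Summit.CriticalPhenomena.Ising3DConformalLimit.RungOneAdjacentMergingDominantShell

end
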